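import Literature.AnabelianGeometry.EtaleTheta.Discharge.Sec2DiscreteNormalizersHolds
import Literature.AnabelianGeometry.SemiGraphs.TemperedAnabelian
import Literature.AnabelianGeometry.SemiGraphs.TemperedCompletionOpenSubgroups
import HarnessLib

/-!
# [SemiAnbd] Lemma 6.1 (iii) and Lemma 6.3 (iii) for `Π^temp_{X_K}`, from the virtually free tower

Mochizuki, *Semi-graphs of anabelioids*, Publ. RIMS **42** (2006) [SemiAnbd], §6, author's
manuscript pp. 69–70:

> **Lemma 6.1 (iii)** (Profinite Normalizers): "We have: `N_{Π_{X_K}}(Π^temp_{X_K}) = Π^temp_{X_K}`."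
> Proof: "Assertion (i) (respectively, (ii)) is the content of [André], Lemma 3.2.1 (respectively,
> [André], Corollary 6.2.2). Assertion (iii) follows immediately from assertion (ii)."
>
> **Lemma 6.3 (iii)** (Dense Subgroups): "Let `F, F̂` be as in (ii)" [`F = Π^temp_{X_K}` or
> `Δ^temp_X`, `F̂` its profinite completion]. "Suppose that `F₁, F₂ ⊆ F` are subgroups of DOF-type
> which are dense in `F̂`. Then, for any `f ∈ F̂` such that `f · F₁ · f⁻¹ = F₂`, it follows that
> `f ∈ F`."  Proof: "assertion (iii) follows from Lemma 6.1, (i) [cf. the proofs of Lemma 6.1,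
> (ii), (iii)]." [cite: MochizukiSemiAnbd2006, Lem 6.1(iii) p.69; Lem 6.3(iii) p.70]

PROOF-ONLY companion (abc-iut cell, sub-DAG `SemiAnbd:Lem6.1(iii)+Lem6.3(iii)`, prover
abc-iut-w5-d240; no definitions, no named facts introduced).  Both statements are proved here for the
`Π^temp`-halves of the typed nodes (`TemperedCurve.PiTempNormallyTerminal`,
`TemperedCurve.PiTempDenseDOFConjugator` of `TemperedAnabelian.lean`) MODULO exactly the two inputs
that the tree's discharge of [EtTh] Lemma 2.17 (ii) uses
(`EtaleTheta/Discharge/Sec2DiscreteNormalizersTemperedFI.lean`):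

* `hT : IsTempered X.PiTemp` — `Π^temp_{X_K}` "is a tempered topological group" (p. 69; [SemiAnbd]
  Def. 3.1 (i)); only completeness is used;
* `htower₀` — the `H`-independent anabelian tower input: cofinally many open normal `N ⊴ Π^temp`
  such that `Π^temp/N` contains a NON-ABELIAN free normal subgroup of finite index and finite rank
  ("[André], §4.5"; the input the printed proof draws from Lemma 6.1 (i) "cf. the proofs of
  Lemma 6.1, (ii), (iii)").

Route (generic, over L3's interfaces `IsTempered` / `IsProfiniteCompletion ι : Π → Π̂`):

* `IsTempered.normalizer_range_eq_of_tower` — `N_{Π̂}(ι Π) = ι Π`: literally the tree's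
  `normalizer_map_eq_of_isTempered_of_finiteIndex` ([EtTh] Lem. 2.17 (ii) for finite-index open `H`,
  with Lemma 2.17 (i) = `DiscreteNormalizers.lem217_i`, PROVED in the tree) at `H = ⊤`;
* `IsProfiniteCompletion.closure_eq_univ_of_isDOFType_of_dense` — a subgroup of DOF-type whose image
  is dense in `Π̂` is dense in `Π` (the open finite-index subgroup it is dense in is pulled back from
  `Π̂`, `comap_topologicalClosure_map`);
* `IsTempered.exists_apply_eq_of_levelwise` — the inverse-limit skeleton of the tree's proof of
  `normalizer_map_eq_of_isTempered` (coherence by residual finiteness of the good quotients,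
  completeness of `Π`, `Π̂ = lim Π̂/V`), factored as a reusable principle: an element of `Π̂` that is
  congruent to an element of `ι Π` at cofinally many residually finite levels lies in `ι Π`;
* `IsTempered.mem_range_of_conj_eq_of_dense` — Lemma 6.3 (iii), generic: at a good level `N` the
  images of `F₁, F₂` are all of `Π/N`, so the image of `f` normalises the image of `Π/N` in `(Π/N)^`
  and lies in it by Lemma 2.17 (i) (= Lemma 6.1 (i) for virtually free groups) at `H = ⊤`.

Closers: `TemperedCurve.piTempNormallyTerminal_of_tower`, `TemperedCurve.piTempDenseDOFConjugator_of_tower`.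
The `Δ^temp`-halves (`DeltaTempNormallyTerminal`, `DeltaTempDenseDOFConjugator`) are over
`X.deltaToHat`, whose `IsProfiniteCompletion` property is not an interface axiom; not treated here.
Classical topological group theory; nothing here concerns the disputed parts of inter-universal
Teichmüller theory or takes a side on [IUTchIII] Cor. 3.12; typed ≠ discharged.
-/

noncomputable section

namespace Literature.AnabelianGeometry.SemiGraphs

open CategoryTheory ProfiniteGrp ProfiniteGrp.ProfiniteCompletion
open _root_.Topology
open scoped Pointwise
open Literature.AnabelianGeometry.EtaleTheta.DiscreteNormalizers

universe u v

section Generic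

variable {P : Type u} [Group P] [TopologicalSpace P] [IsTopologicalGroup P]
variable {Ph : Type v} [Group Ph] [TopologicalSpace Ph] [IsTopologicalGroup Ph]

/-! ### Lemma 6.1 (iii), generic: `N_{Π̂}(Π) = Π` for a tempered group with a good tower -/

/-- **[SemiAnbd] Lemma 6.1 (iii), generic form**: for a tempered group `Π` with profinite completion
`ι : Π → Π̂` admitting cofinally many open normal `N` with `Π/N ⊇` a non-abelian free normal subgroup
of finite index and finite rank, the image `ι(Π)` is its own normaliser in `Π̂`.  This is the tree's
discharge of [EtTh] Lemma 2.17 (ii) for finite-index open subgroups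
(`normalizer_map_eq_of_isTempered_of_finiteIndex`, with 2.17 (i) = `lem217_i`) at `H = Π`.
[cite: MochizukiSemiAnbd2006, Lem 6.1(iii) p.69] -/
theorem IsTempered.normalizer_range_eq_of_tower (hP : IsTempered P) (ι : P →ₜ* Ph)
    (hι : IsProfiniteCompletion ι)
    (htower₀ : ∀ U ∈ 𝓝 (1 : P), ∃ N : OpenNormalSubgroup P, (N : Set P) ⊆ U ∧
      ∃ (G : Subgroup (P ⧸ N.toSubgroup)) (_ : IsFreeGroup G), G.Normal ∧ G.FiniteIndex ∧
        Finite (IsFreeGroup.Generators G) ∧ ∃ a ∈ G, ∃ b ∈ G, a * b ≠ b * a) :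
    Subgroup.normalizer (ι.toMonoidHom.range : Set Ph) = ι.toMonoidHom.range := by
  have hrange : ι.toMonoidHom.range = (⊤ : Subgroup P).map ι.toMonoidHom :=
    MonoidHom.range_eq_map ι.toMonoidHom
  have h := normalizer_map_eq_of_isTempered_of_finiteIndex lem217_i hP ι hι ⊤ isOpen_univ htower₀
  rw [hrange, h]
  congr 1
  exact Subgroup.normalizer_eq_top (⊤ : Subgroup P)

/-! ### DOF-type subgroups with dense image in `Π̂` are dense in `Π` -/

/-- A subgroup `H ≤ Π` of DOF-type whose image is dense in the profinite completion `Π̂` is dense in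
`Π` itself: `H` is dense in an open subgroup `U` of finite index, `ι⁻¹(cl ι U) = U`
(`comap_topologicalClosure_map`), and `cl ι U ⊇ cl ι H = Π̂` forces `U = Π` ("by replacing `F` by an
open subgroup of `F` of finite index", p. 70). [cite: MochizukiSemiAnbd2006, Lem 6.3(iii) p.70] -/
theorem IsProfiniteCompletion.closure_eq_univ_of_isDOFType_of_dense {ι : P →ₜ* Ph}
    (hι : IsProfiniteCompletion ι) {H : Subgroup P} (hH : IsDOFType H)
    (hd : Dense (ι '' (H : Set P))) : closure (H : Set P) = Set.univ := by
  obtain ⟨U, hUo, hUfi, hcl⟩ := hH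
  haveI := hUfi
  have hHU : H ≤ U := fun h hh => by
    rw [← SetLike.mem_coe, ← hcl]
    exact subset_closure hh
  have htop : (U.map ι.toMonoidHom).topologicalClosure = ⊤ := by
    rw [eq_top_iff]
    intro z _
    have hz : z ∈ closure (ι '' (U : Set P)) := closure_mono (Set.image_mono hHU) (hd z)
    rw [← SetLike.mem_coe, Subgroup.topologicalClosure_coe, Subgroup.coe_map]
    exact hz
  have hU : U = ⊤ := by
    rw [← IsProfiniteCompletion.comap_topologicalClosure_map hι U hUo, htop, Subgroup.comap_top]
  rw [hcl, hU, Subgroup.coe_top]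

/-! ### The inverse-limit principle -/

/-- **Inverse-limit principle** (the skeleton of the tree's proof of [EtTh] Lem. 2.17 (ii),
`normalizer_map_eq_of_isTempered`, factored for reuse): let `Π` be tempered with profinite completion
`ι : Π → Π̂` and `a ∈ Π̂`.  Suppose that cofinally many open normal `N ⊴ Π` are "good", that `Π/N` is
residually finite for good `N`, and that at every good level `a` is congruent to some `ι(n_N)`,
`n_N ∈ Π`, modulo every open normal `V ⊴ Π̂` seen at level `N`.  Then `a ∈ ι(Π)`: the `n_N` are
coherent by residual finiteness, glue to `n ∈ Π` by completeness of `Π`, and `a = ι(n)` because the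
open normal subgroups of `Π̂` separate points. [cite: MochizukiSemiAnbd2006, Lem 6.3(iii) p.70] -/
theorem IsTempered.exists_apply_eq_of_levelwise (hP : IsTempered P) (ι : P →ₜ* Ph)
    (hι : IsProfiniteCompletion ι) (a : Ph) (Good : OpenNormalSubgroup P → Prop)
    (hgood : ∀ U ∈ 𝓝 (1 : P), ∃ N : OpenNormalSubgroup P, (N : Set P) ⊆ U ∧ Good N)
    (hrf : ∀ N, Good N → Group.ResiduallyFinite (P ⧸ N.toSubgroup))
    (key : ∀ N, Good N → ∃ n : P,
      ∀ (M : FiniteIndexNormalSubgroup (P ⧸ N.toSubgroup)) (V : OpenNormalSubgroup Ph),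
        M.toSubgroup.comap (QuotientGroup.mk' N.toSubgroup) = V.toSubgroup.comap ι.toMonoidHom →
        a⁻¹ * ι n ∈ V) :
    ∃ n : P, ι n = a := by
  classical
  haveI : CompactSpace Ph := hι.compactSpace
  haveI : T2Space Ph := hι.t2Space
  haveI : TotallyDisconnectedSpace Ph := hι.totallyDisconnectedSpace
  choose nf hnf using key
  -- coherence of the `n_N` along `N₁ ≤ N₂`
  have hcoh : ∀ (N₁ N₂ : OpenNormalSubgroup P) (h₁ : Good N₁) (h₂ : Good N₂),
      N₁.toSubgroup ≤ N₂.toSubgroup → (nf N₁ h₁)⁻¹ * nf N₂ h₂ ∈ N₂.toSubgroup := by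
    intro N₁ N₂ h₁ h₂ hle
    haveI := hrf N₂ h₂
    rw [← QuotientGroup.eq_one_iff]
    apply Group.eq_one_iff_forall_finiteIndexNormalSubroup
    intro M₂
    obtain ⟨ψ₂, hψV₂, -, -⟩ := exists_hom_completion_quotient ι hι N₂
    obtain ⟨V, hV⟩ := hψV₂ M₂
    have hN₁V : N₁.toSubgroup ≤ V.toSubgroup.comap ι.toMonoidHom := by
      rw [← hV]
      intro p hp
      change QuotientGroup.mk' N₂.toSubgroup p ∈ M₂.toSubgroup
      have : QuotientGroup.mk' N₂.toSubgroup p = 1 := by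
        rw [QuotientGroup.mk'_apply, QuotientGroup.eq_one_iff]
        exact hle hp
      rw [this]
      exact one_mem _
    obtain ⟨M₁, hM₁⟩ := exists_level ι hι N₁ V hN₁V
    have e1 : a⁻¹ * ι (nf N₁ h₁) ∈ V := hnf N₁ h₁ M₁ V hM₁
    have e2 : a⁻¹ * ι (nf N₂ h₂) ∈ V := hnf N₂ h₂ M₂ V hV
    have e3 : (nf N₁ h₁)⁻¹ * nf N₂ h₂ ∈ V.toSubgroup.comap ι.toMonoidHom := by
      change ι ((nf N₁ h₁)⁻¹ * nf N₂ h₂) ∈ V.toSubgroup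
      have := V.toSubgroup.mul_mem (V.toSubgroup.inv_mem e1) e2
      simpa [map_mul, map_inv, mul_assoc] using this
    rw [← hV] at e3
    exact e3
  -- the compatible family of cosets and its limit `n ∈ Π` (completeness of `Π`)
  have hchoice : ∀ M₀ : OpenNormalSubgroup P, ∃ N : OpenNormalSubgroup P,
      N.toSubgroup ≤ M₀.toSubgroup ∧ Good N := by
    intro M₀
    obtain ⟨N, hNU, hN⟩ := hgood (M₀ : Set P) M₀.toOpenSubgroup.mem_nhds_one
    exact ⟨N, fun p hp => hNU hp, hN⟩
  choose Nf hNf_le hNf_good using hchoice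
  obtain ⟨n, hn⟩ := hP.complete (fun M₀ => QuotientGroup.mk (nf (Nf M₀) (hNf_good M₀))) (by
    intro M₀ M₀' hle p hp
    have hp' : (nf (Nf M₀) (hNf_good M₀))⁻¹ * p ∈ M₀'.toSubgroup := hle (QuotientGroup.eq.mp hp)
    let W : OpenNormalSubgroup P :=
      { toOpenSubgroup := (Nf M₀).toOpenSubgroup ⊓ (Nf M₀').toOpenSubgroup
        isNormal' := Subgroup.normal_inf_normal (Nf M₀).toSubgroup (Nf M₀').toSubgroup }
    obtain ⟨N'', hN''W, hN''⟩ := hgood (W : Set P) W.toOpenSubgroup.mem_nhds_one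
    have hle₁ : N''.toSubgroup ≤ (Nf M₀).toSubgroup := fun p hp => (hN''W hp).1
    have hle₂ : N''.toSubgroup ≤ (Nf M₀').toSubgroup := fun p hp => (hN''W hp).2
    have c1 := hcoh N'' (Nf M₀) hN'' (hNf_good M₀) hle₁
    have c2 := hcoh N'' (Nf M₀') hN'' (hNf_good M₀') hle₂
    have : (nf (Nf M₀) (hNf_good M₀))⁻¹ * nf (Nf M₀') (hNf_good M₀') ∈ M₀'.toSubgroup := by
      have h3 := M₀'.toSubgroup.mul_mem
        (M₀'.toSubgroup.inv_mem (hle (hNf_le M₀ c1))) (hNf_le M₀' c2)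
      simpa [mul_assoc] using h3
    apply QuotientGroup.eq.mpr
    have h4 := M₀'.toSubgroup.mul_mem (M₀'.toSubgroup.inv_mem this) hp'
    simpa [mul_assoc] using h4)
  -- `n ≡ n_N (mod N)` for every good `N`
  have hnN : ∀ (N : OpenNormalSubgroup P) (hN : Good N), (nf N hN)⁻¹ * n ∈ N.toSubgroup := by
    intro N hN
    have h1 : (nf (Nf N) (hNf_good N))⁻¹ * n ∈ N.toSubgroup := by
      rw [← QuotientGroup.eq]
      exact hn N
    have h2 := hcoh (Nf N) N (hNf_good N) hN (hNf_le N)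
    have := N.toSubgroup.mul_mem (N.toSubgroup.inv_mem h2) h1
    simpa [mul_assoc] using this
  -- `ι n = a`, since the open normal subgroups of `Π̂` separate points
  refine ⟨n, ?_⟩
  have hfinal : a⁻¹ * ι n = 1 := by
    apply eq_one_of_forall_mem_openNormalSubgroup
    intro V
    let M₀ : OpenNormalSubgroup P :=
      { toOpenSubgroup := ⟨V.toSubgroup.comap ι.toMonoidHom, hι.isOpen_comap V⟩
        isNormal' := Subgroup.Normal.comap inferInstance _ }
    obtain ⟨N, hNU, hN⟩ := hgood (M₀ : Set P) M₀.toOpenSubgroup.mem_nhds_one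
    have hNV : N.toSubgroup ≤ V.toSubgroup.comap ι.toMonoidHom := fun p hp => hNU hp
    obtain ⟨M, hM⟩ := exists_level ι hι N V hNV
    have e1 : a⁻¹ * ι (nf N hN) ∈ V := hnf N hN M V hM
    have e2 : ι ((nf N hN)⁻¹ * n) ∈ V.toSubgroup := hNV (hnN N hN)
    have e3 : a⁻¹ * ι n = (a⁻¹ * ι (nf N hN)) * ι ((nf N hN)⁻¹ * n) := by
      rw [map_mul, map_inv]
      group
    rw [e3]
    exact V.toSubgroup.mul_mem e1 e2
  exact (inv_mul_eq_one.mp hfinal).symm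

/-! ### Lemma 6.3 (iii), generic -/

/-- The image in a discrete quotient `Π/N` (`N` open) of a dense subgroup of `Π` is everything.
[cite: MochizukiSemiAnbd2006, Lem 6.3(iii) p.70] -/
theorem map_mk_eq_top_of_closure_eq_univ (N : OpenNormalSubgroup P) {F₁ : Subgroup P}
    (h₁ : closure (F₁ : Set P) = Set.univ) :
    F₁.map (QuotientGroup.mk' N.toSubgroup) = ⊤ := by
  rw [eq_top_iff]
  intro q _
  obtain ⟨x, rfl⟩ := QuotientGroup.mk'_surjective N.toSubgroup q
  have hx : x ∈ closure (F₁ : Set P) := by rw [h₁]; exact Set.mem_univ x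
  have hopen : IsOpen ((fun y => x * y) '' (N : Set P)) :=
    (Homeomorph.mulLeft x).isOpenMap _ N.toOpenSubgroup.isOpen
  obtain ⟨z, ⟨m, hm, rfl⟩, hzF⟩ := mem_closure_iff.mp hx _ hopen ⟨1, N.toSubgroup.one_mem, mul_one x⟩
  refine ⟨x * m, hzF, ?_⟩
  rw [QuotientGroup.mk'_apply, QuotientGroup.mk'_apply, QuotientGroup.eq]
  simpa using N.toSubgroup.inv_mem hm

/-- **[SemiAnbd] Lemma 6.3 (iii), generic form** over a tempered group `Π` with profinite completion
`ι : Π → Π̂` and a good tower (`htower₀`, as in Lemma 6.1 (iii)): if `F₁, F₂ ≤ Π` are DENSE IN `Π`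
and `f ∈ Π̂` conjugates `ι(F₁)` onto `ι(F₂)`, then `f ∈ ι(Π)`.  At each good level `N` the images of
`F₁, F₂` in `Π/N` are everything, so the image of `f` in `(Π/N)^` normalises the image of `Π/N`, hence
lies in it by Lemma 6.1 (i) for virtually free groups ([EtTh] Lem. 2.17 (i) = `lem217_i` at `H = ⊤`);
the levels glue by `exists_apply_eq_of_levelwise` ("cf. the proofs of Lemma 6.1, (ii), (iii)", p. 70).
[cite: MochizukiSemiAnbd2006, Lem 6.3(iii) p.70] -/
theorem IsTempered.mem_range_of_conj_eq_of_closure_eq_univ (hP : IsTempered P) (ι : P →ₜ* Ph)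
    (hι : IsProfiniteCompletion ι)
    (htower₀ : ∀ U ∈ 𝓝 (1 : P), ∃ N : OpenNormalSubgroup P, (N : Set P) ⊆ U ∧
      ∃ (G : Subgroup (P ⧸ N.toSubgroup)) (_ : IsFreeGroup G), G.Normal ∧ G.FiniteIndex ∧
        Finite (IsFreeGroup.Generators G) ∧ ∃ a ∈ G, ∃ b ∈ G, a * b ≠ b * a)
    {F₁ F₂ : Subgroup P} (h₁ : closure (F₁ : Set P) = Set.univ)
    (h₂ : closure (F₂ : Set P) = Set.univ) (f : Ph)
    (hconj : ∀ x ∈ F₁, ∃ y ∈ F₂, f * ι x * f⁻¹ = ι y)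
    (hconj' : ∀ y ∈ F₂, ∃ x ∈ F₁, f * ι x * f⁻¹ = ι y) :
    f ∈ ι.toMonoidHom.range := by
  classical
  -- "goodness" of a level `N`
  let Good : OpenNormalSubgroup P → Prop := fun N =>
    ∃ (G : Subgroup (P ⧸ N.toSubgroup)) (_ : IsFreeGroup G), G.Normal ∧ G.FiniteIndex ∧
      Finite (IsFreeGroup.Generators G) ∧ ∃ a ∈ G, ∃ b ∈ G, a * b ≠ b * a
  have hgood : ∀ U ∈ 𝓝 (1 : P), ∃ N : OpenNormalSubgroup P, (N : Set P) ⊆ U ∧ Good N := htower₀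
  have hrf : ∀ N, Good N → Group.ResiduallyFinite (P ⧸ N.toSubgroup) := by
    rintro N ⟨G, hG, hGn, hGfi, -, -⟩
    haveI := hG
    haveI := hGfi
    haveI := residuallyFinite_of_isFreeGroup G
    exact residuallyFinite_of_finiteIndex G
  obtain ⟨n, hn⟩ := hP.exists_apply_eq_of_levelwise ι hι f Good hgood hrf (by
    rintro N ⟨G, hG, hGn, hGfi, hGfin, a, ha, b, hb, hab⟩
    haveI := hG
    obtain ⟨ψ, hψV, hψι, hψ⟩ := exists_hom_completion_quotient ι hι N
    let π : P →* P ⧸ N.toSubgroup := QuotientGroup.mk' N.toSubgroup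
    let ηQ : (P ⧸ N.toSubgroup) →* completion (GrpCat.of (P ⧸ N.toSubgroup)) :=
      (ProfiniteGrp.ProfiniteCompletion.eta (GrpCat.of (P ⧸ N.toSubgroup))).hom
    have hηQ : ∀ (q : P ⧸ N.toSubgroup) (M : FiniteIndexNormalSubgroup (P ⧸ N.toSubgroup)),
        (ηQ q).val M = (QuotientGroup.mk q : (P ⧸ N.toSubgroup) ⧸ M.toSubgroup) := fun _ _ => rfl
    -- `ψ ∘ ι = ηQ ∘ π`
    have hψι' : ∀ x : P, ψ (ι x) = ηQ (π x) := by
      intro x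
      apply ext_val
      intro M
      rw [hψι, hηQ, QuotientGroup.mk'_apply]
    -- the images of `F₁`, `F₂` at level `N` are everything
    have hF₁ : F₁.map π = ⊤ := map_mk_eq_top_of_closure_eq_univ N h₁
    have hF₂ : F₂.map π = ⊤ := map_mk_eq_top_of_closure_eq_univ N h₂
    -- `ψ f` normalises `ηQ (Π/N) = (⊤ : Subgroup (Π/N)).map ηQ`
    have h1 : ψ f ∈ Subgroup.normalizer
        ((((⊤ : Subgroup (P ⧸ N.toSubgroup)).map ηQ : Subgroup _)) : Set _) := by
      rw [Subgroup.mem_normalizer_iff]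
      intro z
      constructor
      · rintro ⟨q, -, rfl⟩
        -- `q = π x` with `x ∈ F₁`
        have hq : q ∈ F₁.map π := by rw [hF₁]; exact Subgroup.mem_top q
        obtain ⟨x, hx, rfl⟩ := hq
        obtain ⟨y, -, hy⟩ := hconj x hx
        refine ⟨π y, Subgroup.mem_top _, ?_⟩
        rw [← hψι', ← hψι', ← hy, map_mul, map_mul, map_inv]
      · rintro ⟨q, -, hq⟩
        -- `q = π y` with `y ∈ F₂`
        have hq2 : q ∈ F₂.map π := by rw [hF₂]; exact Subgroup.mem_top q
        obtain ⟨y, hy, rfl⟩ := hq2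
        obtain ⟨x, -, hx⟩ := hconj' y hy
        refine ⟨π x, Subgroup.mem_top _, ?_⟩
        have e : ψ f * ψ (ι x) * (ψ f)⁻¹ = ηQ (π y) := by
          rw [← hψι', ← hx, map_mul, map_mul, map_inv]
        -- `z = ψ(ι x)` since `ψ f * z * (ψ f)⁻¹ = ηQ (π y) = ψ f * ψ (ι x) * (ψ f)⁻¹`
        have hz : z = ψ (ι x) := by
          have := hq.symm.trans e.symm
          exact mul_left_cancel (mul_right_cancel this)
        rw [hz, hψι']
    -- Lemma 6.1 (i) for the virtually free group `Π/N`, in the form [EtTh] Lem. 2.17 (i) at `H = ⊤`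
    have h2 : Subgroup.normalizer
        ((((⊤ : Subgroup (P ⧸ N.toSubgroup)).map ηQ : Subgroup _)) : Set _) =
        (Subgroup.normalizer (((⊤ : Subgroup (P ⧸ N.toSubgroup))) :
          Set (P ⧸ N.toSubgroup))).map ηQ :=
      lem217_i (P ⧸ N.toSubgroup) G ⊤ hGn hGfi hGfin
        ⟨a, Subgroup.mem_inf.mpr ⟨Subgroup.mem_top a, ha⟩, b,
          Subgroup.mem_inf.mpr ⟨Subgroup.mem_top b, hb⟩, hab⟩
    rw [h2] at h1
    obtain ⟨q, -, hqf⟩ := h1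
    obtain ⟨n, rfl⟩ := QuotientGroup.mk'_surjective N.toSubgroup q
    refine ⟨n, fun M V hMV => (hψ f M n V hMV).mp ?_⟩
    rw [← hqf]
    exact hηQ _ M)
  exact ⟨n, hn⟩

/-- **[SemiAnbd] Lemma 6.3 (iii), generic form, as printed**: `F₁, F₂ ≤ Π` of DOF-type with images
dense in the profinite completion `Π̂`, and `f ∈ Π̂` with `f · ι(F₁) · f⁻¹ = ι(F₂)` (as subgroups of
`Π̂`) ⇒ `f ∈ ι(Π)`; over a tempered `Π` with a good tower `htower₀`.
[cite: MochizukiSemiAnbd2006, Lem 6.3(iii) p.70] -/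
theorem IsTempered.mem_range_of_conj_eq_of_dense (hP : IsTempered P) (ι : P →ₜ* Ph)
    (hι : IsProfiniteCompletion ι)
    (htower₀ : ∀ U ∈ 𝓝 (1 : P), ∃ N : OpenNormalSubgroup P, (N : Set P) ⊆ U ∧
      ∃ (G : Subgroup (P ⧸ N.toSubgroup)) (_ : IsFreeGroup G), G.Normal ∧ G.FiniteIndex ∧
        Finite (IsFreeGroup.Generators G) ∧ ∃ a ∈ G, ∃ b ∈ G, a * b ≠ b * a)
    (F₁ F₂ : Subgroup P) (hF₁ : IsDOFType F₁) (hF₂ : IsDOFType F₂)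
    (hd₁ : Dense (ι '' (F₁ : Set P))) (hd₂ : Dense (ι '' (F₂ : Set P))) (f : ConjAct Ph)
    (hf : f • F₁.map ι.toMonoidHom = F₂.map ι.toMonoidHom) :
    ConjAct.ofConjAct f ∈ ι.toMonoidHom.range := by
  have h₁ := hι.closure_eq_univ_of_isDOFType_of_dense hF₁ hd₁
  have h₂ := hι.closure_eq_univ_of_isDOFType_of_dense hF₂ hd₂
  refine hP.mem_range_of_conj_eq_of_closure_eq_univ ι hι htower₀ h₁ h₂ (ConjAct.ofConjAct f) ?_ ?_
  · intro x hx
    have hmem : f • ι x ∈ f • F₁.map ι.toMonoidHom :=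
      Subgroup.smul_mem_pointwise_smul (ι x) f (F₁.map ι.toMonoidHom) ⟨x, hx, rfl⟩
    rw [hf] at hmem
    obtain ⟨y, hy, hye⟩ := hmem
    refine ⟨y, hy, ?_⟩
    rw [ConjAct.smul_def] at hye
    exact hye.symm
  · intro y hy
    have hmem : ι y ∈ f • F₁.map ι.toMonoidHom := by
      rw [hf]
      exact ⟨y, hy, rfl⟩
    obtain ⟨z, ⟨x, hx, rfl⟩, hze⟩ :=
      (Subgroup.mem_smul_pointwise_iff_exists (ι y) f (F₁.map ι.toMonoidHom)).mp hmem
    refine ⟨x, hx, ?_⟩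
    rw [ConjAct.smul_def] at hze
    exact hze

end Generic

/-! ### The typed nodes for `F = Π^temp_{X_K}` -/

namespace TemperedCurve

variable {p : ℕ} [Fact p.Prime]

/-- **[SemiAnbd] Lemma 6.1 (iii)** for a datum `X : TemperedCurve p` — the typed node
`X.PiTempNormallyTerminal`, `N_{Π_{X_K}}(Π^temp_{X_K}) = Π^temp_{X_K}` — PROVED modulo
`IsTempered X.PiTemp` ("`Π^temp_{X_K}` is a tempered topological group", p. 69) and the anabelian tower
input `htower₀` (cofinal open normal `N` with `Π^temp_{X_K}/N ⊇` a non-abelian free normal subgroup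
of finite index and finite rank; [André] §4.5), the input the tree's discharge of [EtTh] Lem. 2.17 (ii)
also takes. [cite: MochizukiSemiAnbd2006, Lem 6.1(iii) p.69] -/
theorem piTempNormallyTerminal_of_tower (X : TemperedCurve p) (hT : IsTempered X.PiTemp)
    (htower₀ : ∀ U ∈ 𝓝 (1 : X.PiTemp), ∃ N : OpenNormalSubgroup X.PiTemp, (N : Set X.PiTemp) ⊆ U ∧
      ∃ (G : Subgroup (X.PiTemp ⧸ N.toSubgroup)) (_ : IsFreeGroup G), G.Normal ∧ G.FiniteIndex ∧
        Finite (IsFreeGroup.Generators G) ∧ ∃ a ∈ G, ∃ b ∈ G, a * b ≠ b * a) :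
    X.PiTempNormallyTerminal :=
  hT.normalizer_range_eq_of_tower X.toHat X.isProfiniteCompletion_toHat htower₀

/-- **[SemiAnbd] Lemma 6.3 (iii)** for a datum `X : TemperedCurve p` and `F = Π^temp_{X_K}` — the
typed node `X.PiTempDenseDOFConjugator`: DOF-type subgroups `F₁, F₂ ≤ Π^temp_{X_K}` dense in
`Π_{X_K}` and `f ∈ Π_{X_K}` with `f · F₁ · f⁻¹ = F₂` force `f ∈ Π^temp_{X_K}` — PROVED modulo
`IsTempered X.PiTemp` and the tower input `htower₀` (as in `piTempNormallyTerminal_of_tower`).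
[cite: MochizukiSemiAnbd2006, Lem 6.3(iii) p.70] -/
theorem piTempDenseDOFConjugator_of_tower (X : TemperedCurve p) (hT : IsTempered X.PiTemp)
    (htower₀ : ∀ U ∈ 𝓝 (1 : X.PiTemp), ∃ N : OpenNormalSubgroup X.PiTemp, (N : Set X.PiTemp) ⊆ U ∧
      ∃ (G : Subgroup (X.PiTemp ⧸ N.toSubgroup)) (_ : IsFreeGroup G), G.Normal ∧ G.FiniteIndex ∧
        Finite (IsFreeGroup.Generators G) ∧ ∃ a ∈ G, ∃ b ∈ G, a * b ≠ b * a) :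
    X.PiTempDenseDOFConjugator := fun F₁ F₂ hF₁ hF₂ hd₁ hd₂ f hf =>
  hT.mem_range_of_conj_eq_of_dense X.toHat X.isProfiniteCompletion_toHat htower₀ F₁ F₂ hF₁ hF₂
    hd₁ hd₂ f hf

end TemperedCurve

end Literature.AnabelianGeometry.SemiGraphs

end
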